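import Mathlib
import HarnessLib
import Summits.KontsevichZagierPeriods.KontsevichZagierPeriods.Theses.LinRedNormalForm
import Summits.KontsevichZagierPeriods.KontsevichZagierPeriods.Theorems.LinRedNormalFormDihedralNormalFormVertexSplitting

/-!
# `DihedralNormalForm`: faces of a CLOSED rational form one dimension up (weighted vertex splitting)

Support file (lead a2 of line `torus-descent-sum-shadow`, crux `DihedralNormalForm`,
stmt-KontsevichZagierPeriods-3912, route `LinRedNormalForm`).  The landed `VertexSplitting.vertexSplit`
(p125009) sums the axis moves `nl_axis_osimplex` of ONE primitive `F` over a family of axes whose partial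
derivatives cancel (a translation-invariant form).  The relation family that the engine of the line uses
(`Cruxes/DihedralNormalForm/EngineNotes-a2.md`: closed Arnold forms `Θ = Σ_I c_I ∧_{f∈I} dlog f` on
`Δᵏ⁺¹`, dilation splittings) needs the same statement with a primitive `F i` PER AXIS: if
`Θ = Σᵢ Fᵢ · dt_{≠ axᵢ}` is closed, i.e. `Σᵢ ∂_{axᵢ} Fᵢ = 0` on `Δᵏ⁺¹` (signs absorbed into the `Fᵢ`),
and every axis move applies, then the face terms alone form a relation `Σᵢ [rbᵢ] ∈ KZ.relations`
among representations on `Δᵏ` of the same dimension — Stokes for `Θ` on the cell, the bulk `∫ dΘ = 0`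
having cancelled by rule 1(b).

References: M. Kontsevich, D. Zagier, *Periods* (2001), §1.2 rules (1), (3); F. Brown,
*Multiple zeta values and periods of moduli spaces* (2009), §8 (Stokes on the cell); V. I. Arnold, *The
cohomology ring of the colored braid group* (1969) (closed `dlog` forms).
-/

noncomputable section

open MeasureTheory Set

namespace Summit.KontsevichZagierPeriods.DihedralNormalForm.VertexSplitting

open Literature.NumberTheory.Transcendental

variable {k : ℕ}

/-- **Closed-form splitting** (faces of a closed rational `k`-form on `Δᵏ⁺¹`; weighted vertex
splitting).  Let `S` be a finite family of axes `ax i` with primitives `F i` (one per axis) whose axis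
derivatives `W i = ∂_{ax i} F i` are represented by `R i = [Δᵏ⁺¹, W i]` and cancel pointwise,
`Σᵢ W i = 0` on `Δᵏ⁺¹` (the form `Σᵢ Fᵢ dt_{≠ axᵢ}` is closed).  If for each `i` the axis move
`nl_axis_osimplex` applies with base `rb i = [Δᵏ, F i|_{t = hiEdge} − F i|_{t = loEdge}]`, then
`Σᵢ [rb i] ∈ KZ.relations`.  (`vertexSplit` is the case of a common primitive `F i = F`.)
[cite: KontsevichZagier2001, §1.2 rules (1), (3)] -/
theorem closedFormSplit {ι : Type*} (S : Finset ι) (ax : ι → Fin (k + 1))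
    (R : ι → KZ.IntegralRep (k + 1)) (rb : ι → KZ.IntegralRep k)
    (F : ι → (Fin (k + 1) → ℝ) → ℝ) (W : ι → (Fin (k + 1) → ℝ) → ℝ)
    (hRdom : ∀ i ∈ S, (R i).domain = KZ.openOrderedSimplex (k + 1))
    (hRW : ∀ i ∈ S, EqOn (R i).integrand (W i) (R i).domain)
    (hbdom : ∀ i ∈ S, (rb i).domain = KZ.openOrderedSimplex k)
    (hW : ∀ i ∈ S, IsSemialgebraicFunOn ℚ (sband (ax i)) (W i))
    (hF : ∀ i ∈ S, IsSemialgebraicFunOn ℚ (sband (ax i)) (F i))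
    (hcont : ∀ i ∈ S, ∀ y ∈ KZ.openOrderedSimplex k,
      ContinuousOn (fun t : ℝ => F i (Fin.insertNth (ax i) t y)) (Icc (loEdge (ax i) y) (hiEdge (ax i) y)))
    (hder : ∀ i ∈ S, ∀ y ∈ KZ.openOrderedSimplex k, ∀ t ∈ Ioo (loEdge (ax i) y) (hiEdge (ax i) y),
      HasDerivAt (fun s : ℝ => F i (Fin.insertNth (ax i) s y)) (W i (Fin.insertNth (ax i) t y)) t)
    (hbase : ∀ i ∈ S, ∀ y ∈ KZ.openOrderedSimplex k, (rb i).integrand y =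
      F i (Fin.insertNth (ax i) (hiEdge (ax i) y) y) - F i (Fin.insertNth (ax i) (loEdge (ax i) y) y))
    (hsum : ∀ x ∈ KZ.openOrderedSimplex (k + 1), ∑ i ∈ S, W i x = 0) :
    ∑ i ∈ S, KZ.of (rb i) ∈ KZ.relations := by
  have h1 : ∑ i ∈ S, (KZ.of (R i) - KZ.of (rb i)) ∈ KZ.relations :=
    sum_mem fun i hi => nl_axis_osimplex (ax i) (R i) (rb i) (F i) (W i) (hRdom i hi) (hRW i hi)
      (hbdom i hi) (hW i hi) (hF i hi) (hcont i hi) (hder i hi) (hbase i hi)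
  have h2 : ∑ i ∈ S, KZ.of (R i) ∈ KZ.relations := by
    refine sum_of_mem_relations_of_sum_eqOn_zero S R (KZ.openOrderedSimplex (k + 1)) hRdom ?_
    intro x hx
    rw [← hsum x hx]
    refine Finset.sum_congr rfl fun i hi => hRW i hi ?_
    rw [hRdom i hi]; exact hx
  have e : ∑ i ∈ S, KZ.of (rb i) = ∑ i ∈ S, KZ.of (R i) - ∑ i ∈ S, (KZ.of (R i) - KZ.of (rb i)) := by
    rw [Finset.sum_sub_distrib]; abel
  rw [e]
  exact KZ.relations.sub_mem h2 h1

/-- **Registered sub-goal `stub_closedFormSplit`** (self-contained signature of `closedFormSplit`: the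
faces of a closed rational form one dimension up sum to a relation, one primitive per axis).
[cite: KontsevichZagier2001, §1.2 rules (1), (3)] -/
theorem stub_closedFormSplit : ∀ (k : ℕ) (ι : Type) (S : Finset ι) (ax : ι → Fin (k + 1)) (R : ι → Literature.NumberTheory.Transcendental.KZ.IntegralRep (k + 1)) (rb : ι → Literature.NumberTheory.Transcendental.KZ.IntegralRep k) (F : ι → (Fin (k + 1) → ℝ) → ℝ) (W : ι → (Fin (k + 1) → ℝ) → ℝ), (∀ i ∈ S, (R i).domain = Literature.NumberTheory.Transcendental.KZ.openOrderedSimplex (k + 1)) → (∀ i ∈ S, Set.EqOn (R i).integrand (W i) (R i).domain) → (∀ i ∈ S, (rb i).domain = Literature.NumberTheory.Transcendental.KZ.openOrderedSimplex k) → (∀ i ∈ S, Literature.NumberTheory.Transcendental.IsSemialgebraicFunOn ℚ (Summit.KontsevichZagierPeriods.DihedralNormalForm.VertexSplitting.sband (ax i)) (W i)) → (∀ i ∈ S, Literature.NumberTheory.Transcendental.IsSemialgebraicFunOn ℚ (Summit.KontsevichZagierPeriods.DihedralNormalForm.VertexSplitting.sband (ax i)) (F i)) → (∀ i ∈ S,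 ∀ y ∈ Literature.NumberTheory.Transcendental.KZ.openOrderedSimplex k, ContinuousOn (fun t : ℝ => F i (Fin.insertNth (ax i) t y)) (Set.Icc (Summit.KontsevichZagierPeriods.DihedralNormalForm.VertexSplitting.loEdge (ax i) y) (Summit.KontsevichZagierPeriods.DihedralNormalForm.VertexSplitting.hiEdge (ax i) y))) → (∀ i ∈ S, ∀ y ∈ Literature.NumberTheory.Transcendental.KZ.openOrderedSimplex k, ∀ t ∈ Set.Ioo (Summit.KontsevichZagierPeriods.DihedralNormalForm.VertexSplitting.loEdge (ax i) y) (Summit.KontsevichZagierPeriods.DihedralNormalForm.VertexSplitting.hiEdge (ax i) y), HasDerivAt (fun s : ℝ => F i (Fin.insertNth (ax i) s y)) (W i (Fin.insertNth (ax i) t y)) t) → (∀ i ∈ S, ∀ y ∈ Literature.NumberTheory.Transcendental.KZ.openOrderedSimplex k, (rb i).integrand y = F i (Fin.insertNth (ax i) (Summit.KontsevichZagierPeriods.DihedralNormalForm.VertexSplitting.hiEdge (ax i) y) y) - F i (Fin.insertNth (ax i) (Summit.KontsevichZagierPeriods.DihedralNormalForm.VertexSplitting.loEdge (ax i) y) y))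 → (∀ x ∈ Literature.NumberTheory.Transcendental.KZ.openOrderedSimplex (k + 1), ∑ i ∈ S, W i x = 0) → ∑ i ∈ S, Literature.NumberTheory.Transcendental.KZ.of (rb i) ∈ Literature.NumberTheory.Transcendental.KZ.relations := by
  intro k ι S ax R rb F W hRdom hRW hbdom hW hF hcont hder hbase hsum
  exact closedFormSplit S ax R rb F W hRdom hRW hbdom hW hF hcont hder hbase hsum

end Summit.KontsevichZagierPeriods.DihedralNormalForm.VertexSplitting
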